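import Mathlib
import Summits.SmoothPoincare4.SmoothPoincare4.Theses.SullivanDual
import Literature.Geometry.Symplectic.StandardEnd
import Literature.Geometry.Symplectic.JHolomorphicMap
import Summits.SmoothPoincare4.SmoothPoincare4.Theorems.SullivanDualTameOrBrodyR4Reduction
import Summits.SmoothPoincare4.SmoothPoincare4.Theorems.SullivanDualTameOrBrodyR4PencilDefs
import Summits.SmoothPoincare4.SmoothPoincare4.Theorems.SullivanDualTameOrBrodyR4ContinuityMethod

/-!
# Reduction of the crux `TameOrBrodyR4` to its two deep inputs (stmt-SmoothPoincare4-7826, line `Sketch`, skeleton v8/v9 §4 — lead prover file)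

The crux — every `C^∞` almost complex structure `J` on `ℝ⁴` standard on `‖x‖ ≥ R` is tamed by a
`C^∞` closed 2-form equal to `ω₀` outside a ball OR carries a bounded non-constant entire `J`-curve
(`Summit.SmoothPoincare4.SmoothPoincare4.Theses.SullivanDual.TameOrBrodyR4`) — is proved here,
KERNEL-CHECKED and sorry-free, from exactly FOUR hypotheses, the deep inputs of the line in the
vocabulary of `Theorems/SullivanDualTameOrBrodyR4PencilDefs.lean`, each VERBATIM the registered
signature of a stub of the line skeleton `Cruxes/TameOrBrodyR4/Lines/Sketch.lean`, universally
quantified over `(J, R, P, Q, eP, eQ)`: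

* `hLF` = `stub_localFamily`: `HasLocalFamilies J R P Q` — automatic transversality with the point
  constraint at infinity + implicit function theorem + nowhere-vanishing normal variation
  (Hofer–Lizan–Sikorav 1997 Thm 1; Wendl 2018 Thm 2.44–2.46; McDuff–Salamon 2012 Thm 3.1.5);
* `hUD` = `stub_uniqueDisjoint`: `HasUniqueDisjointMembers J R P Q`, `hEL` = `stub_embeddedLimits`:
  `HasEmbeddedLimits J R P Q`, `hT` = `stub_transverse`: `HasTransverseMembers J R P Q` — the positivity
  package: positivity of intersections and the adjunction inequality in dimension four (McDuff 1991;
  Micallef–White 1995; McDuff–Salamon 2012 Thm 2.6.3–2.6.4, App. E; `A·A = 0`, `A·B = 1`).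

Everything else is in the tree: the continuity method `stub_continuity`
(`…ContinuityMethod.lean`, over `…ContinuityEstimates.lean`, `…ContinuityClosedness.lean` and the
six classical stubs `stub_confineQ`, `stub_sigmaGrowth`, `stub_farInverse`, `stub_compactnessLoc`,
`stub_limitTails`, `stub_limitCrossings`), applied to the concrete frames `(z, w)` and `(w, z)`
(`exists_frames`), gives Gromov's two complete anchored pencils as evaluation maps at radius `3R`
or blow-up data (`pencilsOrBlowup₃_of_deep`); the landed reduction `Reduction.anchorsOrBlowup_of`
at radius `3R`, the pencil chart `stub_chartOfAnchors`, taming `stub_chartTames`, gluing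
`stub_gluing`, and `helper_curveOfBlowup` conclude (`TameOrBrodyR4_of_deep`; registered arrow form
`helper_reductionToDeepInputs`). So the crux closes by one application the day the four deep inputs
are proved; they are the items to promote.

References: M. Gromov, Invent. Math. 82 (1985), §2.4.A; D. McDuff, JAMS 3 (1990); H. Hofer,
V. Lizan, J.-C. Sikorav, J. Geom. Anal. 7 (1997); C. Wendl, LNM 2216 (2018), Thm 2.44–2.46, 6.8;
D. McDuff, D. Salamon, *J-holomorphic curves and symplectic topology*, 2nd ed. (2012).
-/

-- the registered namespace `Summit.SmoothPoincare4.SmoothPoincare4.…` repeats a component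
set_option linter.dupNamespace false

noncomputable section

open scoped ContDiff Topology InnerProductSpace
open Filter Set Literature.Geometry.Symplectic

namespace Summit.SmoothPoincare4.SmoothPoincare4.Cruxes.TameOrBrodyR4.Sketch

/-- Local notation for the model space `ℝ⁴ = EuclideanSpace ℝ (Fin 4)`. -/
local notation "E4" => EuclideanSpace ℝ (Fin 4)

/-- The concrete frames `(z, w)` and `(w, z)` of `ℝ⁴ = ℂ_z × ℂ_w`: coordinate maps
`z x = x₀ + i x₁`, `w x = x₂ + i x₃` with their sections. -/
theorem exists_frames :
    ∃ (Z W : E4 →L[ℝ] ℂ) (eZ eW : ℂ →L[ℝ] E4), (∀ x, Z x = Complex.mk (x 0) (x 1)) ∧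
      (∀ x, W x = Complex.mk (x 2) (x 3)) ∧ IsCoordFrame Z W eZ eW ∧ IsCoordFrame W Z eW eZ := by
  obtain ⟨Z, hZ⟩ := ChartOfAnchors.exists_clm_mk 0 1
  obtain ⟨W, hW⟩ := ChartOfAnchors.exists_clm_mk 2 3
  let eZ : ℂ →L[ℝ] E4 := LinearMap.toContinuousLinearMap
    { toFun := fun ξ => WithLp.toLp 2 ![ξ.re, ξ.im, 0, 0]
      map_add' := by intro a a'; ext i; fin_cases i <;> simp
      map_smul' := by intro s a; ext i; fin_cases i <;> simp }
  let eW : ℂ →L[ℝ] E4 := LinearMap.toContinuousLinearMap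
    { toFun := fun ξ => WithLp.toLp 2 ![0, 0, ξ.re, ξ.im]
      map_add' := by intro a a'; ext i; fin_cases i <;> simp
      map_smul' := by intro s a; ext i; fin_cases i <;> simp }
  have heZ : ∀ ξ : ℂ, eZ ξ = WithLp.toLp 2 ![ξ.re, ξ.im, 0, 0] := fun _ => rfl
  have heW : ∀ ξ : ℂ, eW ξ = WithLp.toLp 2 ![0, 0, ξ.re, ξ.im] := fun _ => rfl
  have hpy : ∀ x : E4, ‖x‖ ^ 2 = ‖Z x‖ ^ 2 + ‖W x‖ ^ 2 := fun x => by
    rw [EuclideanSpace.real_norm_sq_eq, Fin.sum_univ_four, hZ, hW, Complex.sq_norm, Complex.sq_norm,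
      Complex.normSq_apply, Complex.normSq_apply]
    ring
  have h1 : ∀ ξ : ℂ, Z (eZ ξ) = ξ := fun ξ => by rw [hZ, heZ]; apply Complex.ext <;> simp
  have h2 : ∀ ξ : ℂ, W (eZ ξ) = 0 := fun ξ => by rw [hW, heZ]; apply Complex.ext <;> simp
  have h3 : ∀ b : ℂ, Z (eW b) = 0 := fun b => by rw [hZ, heW]; apply Complex.ext <;> simp
  have h4 : ∀ b : ℂ, W (eW b) = b := fun b => by rw [hW, heW]; apply Complex.ext <;> simp
  have h5 : ∀ x : E4, eZ (Z x) + eW (W x) = x := fun x => by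
    rw [heZ, heW, hZ, hW]; ext i; fin_cases i <;> simp
  refine ⟨Z, W, eZ, eW, hZ, hW, ⟨hpy, h1, h2, h3, h4, h5⟩, ⟨fun x => by rw [hpy x, add_comm], h4, h3,
    h2, h1, fun x => by rw [add_comm, h5 x]⟩⟩

/-- **The research core at radius `3R` from the deep inputs** (the v7 registered
`stub_pencilsOrBlowup` with `3R` for `R` in its conclusion, `J` still standard from `R` on): from
`stub_continuity` for the frames `(z, w)` and `(w, z)` and the transversality clause of the
positivity package. -/
theorem pencilsOrBlowup₃_of_deep
    (hLF : ∀ (J : E4 → E4 →L[ℝ] E4) (R : ℝ) (P Q : E4 →L[ℝ] ℂ) (eP eQ : ℂ →L[ℝ] E4),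
      0 < R → ContDiff ℝ ∞ J → (∀ x v, J x (J x v) = -v) → IsCoordFrame P Q eP eQ →
      (∀ x : E4, R ≤ ‖x‖ → ∀ v, P (J x v) = Complex.I * P v) →
      (∀ x : E4, R ≤ ‖x‖ → ∀ v, Q (J x v) = Complex.I * Q v) → HasLocalFamilies J R P Q)
    (hUD : ∀ (J : E4 → E4 →L[ℝ] E4) (R : ℝ) (P Q : E4 →L[ℝ] ℂ) (eP eQ : ℂ →L[ℝ] E4),
      0 < R → ContDiff ℝ ∞ J → (∀ x v, J x (J x v) = -v) → IsCoordFrame P Q eP eQ →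
      (∀ x : E4, R ≤ ‖x‖ → ∀ v, P (J x v) = Complex.I * P v) →
      (∀ x : E4, R ≤ ‖x‖ → ∀ v, Q (J x v) = Complex.I * Q v) → HasUniqueDisjointMembers J R P Q)
    (hEL : ∀ (J : E4 → E4 →L[ℝ] E4) (R : ℝ) (P Q : E4 →L[ℝ] ℂ) (eP eQ : ℂ →L[ℝ] E4),
      0 < R → ContDiff ℝ ∞ J → (∀ x v, J x (J x v) = -v) → IsCoordFrame P Q eP eQ →
      (∀ x : E4, R ≤ ‖x‖ → ∀ v, P (J x v) = Complex.I * P v) →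
      (∀ x : E4, R ≤ ‖x‖ → ∀ v, Q (J x v) = Complex.I * Q v) → HasEmbeddedLimits J R P Q)
    (hT : ∀ (J : E4 → E4 →L[ℝ] E4) (R : ℝ) (P Q : E4 →L[ℝ] ℂ) (eP eQ : ℂ →L[ℝ] E4),
      0 < R → ContDiff ℝ ∞ J → (∀ x v, J x (J x v) = -v) → IsCoordFrame P Q eP eQ →
      (∀ x : E4, R ≤ ‖x‖ → ∀ v, P (J x v) = Complex.I * P v) →
      (∀ x : E4, R ≤ ‖x‖ → ∀ v, Q (J x v) = Complex.I * Q v) → HasTransverseMembers J R P Q)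
    (J : E4 → E4 →L[ℝ] E4) (R : ℝ) (hR : 0 < R)
    (hJs : ContDiff ℝ ∞ J) (hJ2 : ∀ x v, J x (J x v) = -v)
    (hJi : ∀ x : E4, R ≤ ‖x‖ → ∀ a b : E4, ⟪J x a, b⟫_ℝ = stdSymplecticForm a b) :
    (∃ F G : ℂ → ℂ → E4,
      ContDiff ℝ ∞ (fun p : ℂ × ℂ => F p.1 p.2) ∧ ContDiff ℝ ∞ (fun p : ℂ × ℂ => G p.1 p.2) ∧
      Function.Bijective (fun p : ℂ × ℂ => F p.1 p.2) ∧
      Function.Bijective (fun p : ℂ × ℂ => G p.1 p.2) ∧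
      (∀ p : ℂ × ℂ, Function.Bijective (fderiv ℝ (fun p : ℂ × ℂ => F p.1 p.2) p)) ∧
      (∀ p : ℂ × ℂ, Function.Bijective (fderiv ℝ (fun p : ℂ × ℂ => G p.1 p.2) p)) ∧
      (∀ b, IsJHolomorphicFlat J (F b)) ∧ (∀ c, IsJHolomorphicFlat J (G c)) ∧
      (∀ b : ℂ, 3 * R ≤ ‖b‖ → ∀ ξ, Complex.mk (F b ξ 2) (F b ξ 3) = b) ∧
      (∀ x : E4, 3 * R ≤ ‖Complex.mk (x 2) (x 3)‖ → ∃ ξ, F (Complex.mk (x 2) (x 3)) ξ = x) ∧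
      (∀ c : ℂ, 3 * R ≤ ‖c‖ → ∀ η, Complex.mk (G c η 0) (G c η 1) = c) ∧
      (∀ x : E4, 3 * R ≤ ‖Complex.mk (x 0) (x 1)‖ → ∃ η, G (Complex.mk (x 0) (x 1)) η = x) ∧
      (∀ b c : ℂ, 3 * R ≤ ‖c‖ → ∃! ξ, Complex.mk (F b ξ 0) (F b ξ 1) = c) ∧
      (∀ b ξ : ℂ, 3 * R ≤ ‖Complex.mk (F b ξ 0) (F b ξ 1)‖ →
        Function.Bijective (fderiv ℝ (fun ξ => Complex.mk (F b ξ 0) (F b ξ 1)) ξ)) ∧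
      (∀ c b : ℂ, 3 * R ≤ ‖b‖ → ∃! η, Complex.mk (G c η 2) (G c η 3) = b) ∧
      (∀ c η : ℂ, 3 * R ≤ ‖Complex.mk (G c η 2) (G c η 3)‖ →
        Function.Bijective (fderiv ℝ (fun η => Complex.mk (G c η 2) (G c η 3)) η)) ∧
      (∀ b, Tendsto (fun ξ => Complex.mk (F b ξ 2) (F b ξ 3)) (cocompact ℂ) (𝓝 b)) ∧
      (∀ c, Tendsto (fun η => Complex.mk (G c η 0) (G c η 1)) (cocompact ℂ) (𝓝 c)) ∧
      (∀ b ξ c η, F b ξ = G c η → ∀ v v' : ℂ,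
        fderiv ℝ (F b) ξ v = fderiv ℝ (G c) η v' → v = 0)) ∨
    (∃ (K : Set E4) (f : ℕ → ℂ → E4), IsCompact K ∧ (∀ n, ContDiff ℝ ∞ (f n)) ∧
      (∀ n, IsJHolomorphicFlat J (f n)) ∧ (∀ n (z : ℂ), ‖z‖ ≤ 1 → f n z ∈ K) ∧
      Tendsto (fun n => ‖fderiv ℝ (f n) 0‖) atTop atTop) := by
  obtain ⟨Z, W, eZ, eW, hZ, hW, hF1, hF2⟩ := exists_frames
  have hJZ : ∀ x : E4, R ≤ ‖x‖ → ∀ v, Z (J x v) = Complex.I * Z v := fun x hx v => by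
    rw [hZ, hZ]; exact (Reduction.coordinate_J_mul (hJi x hx) v).1
  have hJW : ∀ x : E4, R ≤ ‖x‖ → ∀ v, W (J x v) = Complex.I * W v := fun x hx v => by
    rw [hW, hW]; exact (Reduction.coordinate_J_mul (hJi x hx) v).2
  have h23 : ∀ {c : ℂ}, 3 * R ≤ ‖c‖ → 2 * R < ‖c‖ := fun hc => by linarith
  -- deep inputs for both frames
  have hUD1 := hUD J R Z W eZ eW hR hJs hJ2 hF1 hJZ hJW
  have hEL1 := hEL J R Z W eZ eW hR hJs hJ2 hF1 hJZ hJW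
  have hT1 := hT J R Z W eZ eW hR hJs hJ2 hF1 hJZ hJW
  have hUD' := hUD J R W Z eW eZ hR hJs hJ2 hF2 hJW hJZ
  have hEL' := hEL J R W Z eW eZ hR hJs hJ2 hF2 hJW hJZ
  have hLF1 := hLF J R Z W eZ eW hR hJs hJ2 hF1 hJZ hJW
  have hLF' := hLF J R W Z eW eZ hR hJs hJ2 hF2 hJW hJZ
  rcases stub_continuity J R Z W eZ eW hR hJs hJ2 hF1 hJZ hJW hLF1 hUD1 hEL1 with
    ⟨F, hFs, hFb, hFd, hFm, hF5, hF5'⟩ | hblow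
  · rcases stub_continuity J R W Z eW eZ hR hJs hJ2 hF2 hJW hJZ hLF' hUD' hEL' with
      ⟨G, hGs, hGb, hGd, hGm, hG5, hG5'⟩ | hblow
    · left
      refine ⟨F, G, hFs, hGs, hFb, hGb, hFd, hGd, fun b => (hFm b).2.1, fun c => (hGm c).2.1,
        ?_, ?_, ?_, ?_, ?_, ?_, ?_, ?_, ?_, ?_, ?_⟩
      · intro b hb ξ; rw [← hW]; exact hF5 b hb ξ
      · intro x hx; rw [← hW] at hx ⊢; exact hF5' x hx
      · intro c hc η; rw [← hZ]; exact hG5 c hc η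
      · intro x hx; rw [← hZ] at hx ⊢; exact hG5' x hx
      · intro b c hc; simp only [← hZ]; exact (hFm b).2.2.2.2.2.2.1 c (h23 hc)
      · intro b ξ h; simp only [← hZ] at h ⊢; exact (hFm b).2.2.2.2.2.2.2 ξ (h23 h)
      · intro c b hb; simp only [← hW]; exact (hGm c).2.2.2.2.2.2.1 b (h23 hb)
      · intro c η h; simp only [← hW] at h ⊢; exact (hGm c).2.2.2.2.2.2.2 η (h23 h)
      · intro b; simp only [← hW]; exact (hFm b).2.2.2.2.1
      · intro c; simp only [← hZ]; exact (hGm c).2.2.2.2.1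
      · intro b ξ c η hx v v' hv
        exact hT1 b c (F b) (G c) (hFm b) (hGm c) ξ η hx v v' hv
    · exact Or.inr hblow
  · exact Or.inr hblow

/-- **The crux reduces to the two deep inputs.** `TameOrBrodyR4` by name from `HasLocalFamilies`
and the positivity package for every admissible `(J, R, frame)`: `J` standard on `‖x‖ ≥ R` is
standard on `‖x‖ ≥ 3R`; the research core at radius `3R` (`pencilsOrBlowup₃`) feeds the landed
reduction `Reduction.anchorsOrBlowup_of` at radius `3R`, then the pencil chart
(`stub_chartOfAnchors`), taming (`stub_chartTames`) and gluing (`stub_gluing`) — disjunct 1; blow-up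
data give a bounded non-constant entire `J`-curve (`helper_curveOfBlowup`) — disjunct 2. -/
theorem TameOrBrodyR4_of_deep
    (hLF : ∀ (J : E4 → E4 →L[ℝ] E4) (R : ℝ) (P Q : E4 →L[ℝ] ℂ) (eP eQ : ℂ →L[ℝ] E4),
      0 < R → ContDiff ℝ ∞ J → (∀ x v, J x (J x v) = -v) → IsCoordFrame P Q eP eQ →
      (∀ x : E4, R ≤ ‖x‖ → ∀ v, P (J x v) = Complex.I * P v) →
      (∀ x : E4, R ≤ ‖x‖ → ∀ v, Q (J x v) = Complex.I * Q v) → HasLocalFamilies J R P Q)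
    (hUD : ∀ (J : E4 → E4 →L[ℝ] E4) (R : ℝ) (P Q : E4 →L[ℝ] ℂ) (eP eQ : ℂ →L[ℝ] E4),
      0 < R → ContDiff ℝ ∞ J → (∀ x v, J x (J x v) = -v) → IsCoordFrame P Q eP eQ →
      (∀ x : E4, R ≤ ‖x‖ → ∀ v, P (J x v) = Complex.I * P v) →
      (∀ x : E4, R ≤ ‖x‖ → ∀ v, Q (J x v) = Complex.I * Q v) → HasUniqueDisjointMembers J R P Q)
    (hEL : ∀ (J : E4 → E4 →L[ℝ] E4) (R : ℝ) (P Q : E4 →L[ℝ] ℂ) (eP eQ : ℂ →L[ℝ] E4),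
      0 < R → ContDiff ℝ ∞ J → (∀ x v, J x (J x v) = -v) → IsCoordFrame P Q eP eQ →
      (∀ x : E4, R ≤ ‖x‖ → ∀ v, P (J x v) = Complex.I * P v) →
      (∀ x : E4, R ≤ ‖x‖ → ∀ v, Q (J x v) = Complex.I * Q v) → HasEmbeddedLimits J R P Q)
    (hT : ∀ (J : E4 → E4 →L[ℝ] E4) (R : ℝ) (P Q : E4 →L[ℝ] ℂ) (eP eQ : ℂ →L[ℝ] E4),
      0 < R → ContDiff ℝ ∞ J → (∀ x v, J x (J x v) = -v) → IsCoordFrame P Q eP eQ →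
      (∀ x : E4, R ≤ ‖x‖ → ∀ v, P (J x v) = Complex.I * P v) →
      (∀ x : E4, R ≤ ‖x‖ → ∀ v, Q (J x v) = Complex.I * Q v) → HasTransverseMembers J R P Q) :
    Summit.SmoothPoincare4.SmoothPoincare4.Theses.SullivanDual.TameOrBrodyR4 := by
  intro J R hR hJs hJ2 hJi
  have hR3 : 0 < 3 * R := by positivity
  have hJi3 : ∀ x : E4, 3 * R ≤ ‖x‖ → ∀ a b : E4, ⟪J x a, b⟫_ℝ = stdSymplecticForm a b :=
    fun x hx => hJi x (by linarith)
  rcases Reduction.anchorsOrBlowup_of J (3 * R) hR3 hJi3 (pencilsOrBlowup₃_of_deep hLF hUD hEL hT J R hR hJs hJ2 hJi) with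
    ⟨b, c, hb, hc, hbs, hcs, hbJ, hcJ, htr, hch, hbh, hbD, hcD, hC⟩ |
    ⟨K, f, hK, hf, hfJ, hfK, hblow⟩
  · left
    obtain ⟨Φ, hΦ, hbij, hA, hB, hposA, hposB, hD, hC'⟩ :=
      stub_chartOfAnchors J (3 * R) hJs hJ2 hJi3 b c hb hc hbs hcs hbJ hcJ htr hch hbh hbD hcD hC
    exact stub_gluing J (3 * R) hR3 hJi3 Φ hΦ hD hC' (stub_chartTames J Φ hbij hA hB hposA hposB)
  · right
    obtain ⟨u, hu⟩ := helper_curveOfBlowup J hJs hJ2 K f hK hf hfJ hfK hblow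
    exact ⟨u, hu.1, hu.2.1, hu.2.2.1, hu.2.2.2⟩


/-- **Registered helper `helper_reductionToDeepInputs`** (arrow form of `TameOrBrodyR4_of_deep`):
local families ⇒ uniqueness/disjointness ⇒ embedded limits ⇒ transversality ⇒ crux. -/
theorem helper_reductionToDeepInputs :
    (∀ (J : E4 → E4 →L[ℝ] E4) (R : ℝ) (P Q : E4 →L[ℝ] ℂ) (eP eQ : ℂ →L[ℝ] E4),
      0 < R → ContDiff ℝ ∞ J → (∀ x v, J x (J x v) = -v) → IsCoordFrame P Q eP eQ →
      (∀ x : E4, R ≤ ‖x‖ → ∀ v, P (J x v) = Complex.I * P v) →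
      (∀ x : E4, R ≤ ‖x‖ → ∀ v, Q (J x v) = Complex.I * Q v) → HasLocalFamilies J R P Q) →
    (∀ (J : E4 → E4 →L[ℝ] E4) (R : ℝ) (P Q : E4 →L[ℝ] ℂ) (eP eQ : ℂ →L[ℝ] E4),
      0 < R → ContDiff ℝ ∞ J → (∀ x v, J x (J x v) = -v) → IsCoordFrame P Q eP eQ →
      (∀ x : E4, R ≤ ‖x‖ → ∀ v, P (J x v) = Complex.I * P v) →
      (∀ x : E4, R ≤ ‖x‖ → ∀ v, Q (J x v) = Complex.I * Q v) → HasUniqueDisjointMembers J R P Q) →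
    (∀ (J : E4 → E4 →L[ℝ] E4) (R : ℝ) (P Q : E4 →L[ℝ] ℂ) (eP eQ : ℂ →L[ℝ] E4),
      0 < R → ContDiff ℝ ∞ J → (∀ x v, J x (J x v) = -v) → IsCoordFrame P Q eP eQ →
      (∀ x : E4, R ≤ ‖x‖ → ∀ v, P (J x v) = Complex.I * P v) →
      (∀ x : E4, R ≤ ‖x‖ → ∀ v, Q (J x v) = Complex.I * Q v) → HasEmbeddedLimits J R P Q) →
    (∀ (J : E4 → E4 →L[ℝ] E4) (R : ℝ) (P Q : E4 →L[ℝ] ℂ) (eP eQ : ℂ →L[ℝ] E4),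
      0 < R → ContDiff ℝ ∞ J → (∀ x v, J x (J x v) = -v) → IsCoordFrame P Q eP eQ →
      (∀ x : E4, R ≤ ‖x‖ → ∀ v, P (J x v) = Complex.I * P v) →
      (∀ x : E4, R ≤ ‖x‖ → ∀ v, Q (J x v) = Complex.I * Q v) → HasTransverseMembers J R P Q) →
    Summit.SmoothPoincare4.SmoothPoincare4.Theses.SullivanDual.TameOrBrodyR4 :=
  fun hLF hUD hEL hT => TameOrBrodyR4_of_deep hLF hUD hEL hT

end Summit.SmoothPoincare4.SmoothPoincare4.Cruxes.TameOrBrodyR4.Sketch
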